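import Summits.QuantumAdvantage.QuantumAdvantage.Theses.WhiteBoxWalk
import Literature.Computability.QuantumComplexity.SinkOfVerifiableLine
import Literature.Computability.QuantumComplexity.RandomizedQuerySimulation
import Literature.Computability.QuantumComplexity.ExactQuantumQuery

/-!
# Disproof workfile for the crux `WhiteBoxWalk.WbwVerifiableLineNoSpeedup` (stmt-QuantumAdvantage-2239)

Standing adversary (cdisprove), generation 1, cycle 1
(refuter-cdisprove-stmt-QuantumAdvantage-2239-0). Prose lives in docstrings only; everything
is sorry-free (the former near-miss of §5 is now PROVED, in the Negative/ files), axioms ⊆ {propext, Classical.choice, Quot.sound}.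

THE CRUX (read back through the named tables of `SinkOfVerifiableLine.lean`, `crux_iff` below, by
`Iff.rfl`):

  `∃ c > 0, ∀ m T, 2 ≤ m → 1 ≤ T → T + 1 ≤ 2^(m-1) →
      c · min (T+1) √(2^m) / m ≤ Q_{1/3}(svlPromise m T, svlSinkBit m T)`

where `Q_{1/3}` = `quantumQueryComplexityOn (1/3)` (BBCMdW matrix model, bit queries to the
`2^m·m + 2^m·(T+1)` table bits of `(S, V)`), the promise is "there is a simple verifiable line
`x₀ = 0, …, x_T` (S(xᵢ) = xᵢ₊₁, V(x,i) = [x = xᵢ])" and the function is the parity of the sink `x_T`.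

VERDICT (cycle 1): RESISTS — and, stronger, the attack produced a PROOF ROUTE (§7): on paper the
crux follows from Ambainis's weighted relational adversary method (2002, Thm 6) applied to
PERMUTATION instances all of whose cycles are longer than `T`, with the output-transposition
relation, plus a padding reduction for `T > 2^m/8`; the combinatorial counts behind the bound were
brute-force checked (kit job j008991, `compute/adv_check.py`). The planner's worry ("verified
jumping") is exactly the `V`-entry term of the adversary denominator, `‖Γ_(x,i)‖ ≤ T√(2N)`, which
caps the bound at `√N` — the Grover branch — and nothing worse. No kill is expected to exist.
`crux_of_smallT_of_padding` (checked) reduces the crux to the two named targets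
`SvlAdversarySmallT` and `PaddingMonotone`. See §6 for the attack ledger, §7 for the route.

## Findings (index)

* §0 `crux_iff` — the crux restated over `svlPromise`/`svlSinkBit` (`Iff.rfl`); `svlQ m T` is the
  quantity bounded.
* §1 HYPOTHESIS BOOKKEEPING: `two_le_of_hyps` — the hypothesis `2 ≤ m` is IMPLIED by `1 ≤ T` and
  `T + 1 ≤ 2^(m-1)` (decoration; provers may ignore it). `succ_succ_le_two_pow_of_hyps` — the
  hypotheses leave room for a sink of either parity (`T + 2 ≤ 2^m`).
* §2 LOAD-BEARING ANALYSIS (each remaining hypothesis is necessary):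
  `wbwVerifiableLineNoSpeedup_false_without_Tpos` — drop `1 ≤ T`: at `T = 0` the sink is the source
  `0`, the function is constantly `false` on the promise, `Q = 0 < c/m` (zero-query algorithm
  `constAlg`); `wbwVerifiableLineNoSpeedup_false_without_Tbound` — drop `T + 1 ≤ 2^(m-1)`: at
  `T + 1 > 2^m` the promise set is EMPTY, `Q = 0`. (The intermediate window
  `2^(m-1) ≤ T ≤ 2^m - 1` is not load-bearing in any provable sense: the statement there is as
  plausible as the crux; the planner's `2^(m-1)` only buys slack `2^m - T ≥ 2^(m-1)` for the
  hybrid argument.)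
* §3 THE POINTWISE (quantifier-swapped) WEAKENING IS TRUE: `one_le_svlQ` (under the hypotheses
  `Q ≥ 1`: the sink bit is non-constant on the promise — lines `0,1,…,T-1,T` and `0,1,…,T-1,T+1` —
  and a zero-query algorithm has input-independent acceptance) and `pointwise_bound` :
  `∀ m T, hyps → ∃ c > 0, c·min(T+1)√(2^m)/m ≤ Q`. CONSEQUENCE FOR ANY DISPROOF: a refutation must
  be ASYMPTOTIC — an infinite family `(m_k, T_k)` with `Q = o(min(T,2^{m/2})/m)`, i.e. a genuinely
  new quantum algorithm for pointer chasing with verification; no finite computation can refute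
  the crux. Also recorded: on the promise, block sensitivity and certificate complexity of the
  sink bit are `1` at EVERY instance (the single bit `V(x_T, T) = 1` certifies the answer), so all
  single-input lower-bound methods stop at `Q ≥ 1` (§6); the prover needs a distributional
  hybrid / adversary argument.
* §4 TIGHTNESS of the walk branch: `svlQ_le_mul` (`Q ≤ m·T`, from the tree's line-following tree
  and `Q ≤ R ≤ D`), `svlQ_one_le_one` (`Q(m,1) ≤ 1`: one bit of `S(0)`), hence
  `admissible_const_le_one` (every admissible `c` is `≤ 1`) and the refuted strengthening
  `not_groverBranchOnly` : `¬ ∃ c > 0, ∀ m T, hyps → c·√(2^m)/m ≤ Q` — the `min` cannot be replaced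
  by its Grover branch; the walk branch `T + 1` is attained up to the factor `m²`.
* §5 GROVER-BRANCH TIGHTNESS (PROVED this cycle, landed on the Negative/ lane because the work
  file cannot import unlanded modules): `Negative/QueryReindex.lean` (p74512: re-indexing a
  `QQueryAlg` along `src : Fin N₁ → Fin N₀`, `acceptProb (reindexAlg src A) t = acceptProb A (t ∘ src)`,
  hence `Q_ε(D₀,f₀) ≤ Q_ε(D₁,f₁)` for bit-copy reductions), `Negative/GroverTight.lean` (to file
  after p74512 lands: `Q_{1/3}(SVL_{m,T}) ≤ Q_{1/3}(OR_{2^(m-1)}) ≤ 76 √(2^(m-1)) ≤ 54 √(2^m)`,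
  and `not_walkBranchOnly : ¬ ∃ c > 0, ∀ m T, hyps → c (T+1)/m ≤ Q` — BOTH branches of the `min`
  are necessary), `Negative/Padding.lean` (to file after p74512: `PaddingMonotone` PROVED —
  `quantumQueryComplexityOn_svl_pad : 1 ≤ m → T' < T → T ≤ 2^m → Q_ε(m,T') ≤ Q_ε(m+1,T)`).
  Statements recorded here as `GroverBranchTight` / `PaddingMonotone` (defs).
* §7 PROOF ROUTE FOUND WHILE ATTACKING (new): `SvlAdversarySmallT` (target: `κ·min(T, √(2^m)) ≤ Q`
  for `8T ≤ 2^m`, = Ambainis Thm 6 on long-cycle permutation instances — relation, counts and the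
  brute-force check in the docstring), `PaddingMonotone` (target: `Q(m,T') ≤ Q(m+1,T)` for
  `1 ≤ T' ≤ T ≤ 2^m`, an explicit bit-copy embedding of instances), `WeightedAdversaryBound` (the
  generic theorem missing from the tree, stated in the tree's model), and the CHECKED reduction
  `crux_of_smallT_of_padding : SvlAdversarySmallT → PaddingMonotone → WbwVerifiableLineNoSpeedup`
  (constants: `c = min(κ/2, 1/4)`; cases `8T ≤ 2^m` / `m < 7` / pad from `(m-1, 2^(m-5))`).
* §6 PROSE: attack ledger (candidate algorithms and their costs), the simple hybrid bound
  `min(T, Ω(√(2^m/T)))` and exactly where it falls short of the crux (`2^{m/3} < T`), the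
  "accidental hit" term and why it cannot be exploited (no checker ⇒ no amplification; every
  checker is a point function on (name, index) pairs ⇒ pair search ⇒ `2^{m/2}`), literature
  for the prover (Ozhigov 1998; BBBV 1997; compressed-oracle sequentiality bounds for hash chains:
  Chung–Fehr–Huang–Liao EUROCRYPT 2021, Blocki–Lee–Zhou ITC 2021 — the `S`-half for large `T`),
  and the structural remark that the crux is CALIBRATION ONLY (not in the implication chain
  X → PL → QuantumAdvantage; `closes` uses WbwThesis, WbwPromiseLift, WbwSearchToPromise).
-/

noncomputable section

set_option linter.dupNamespace false

namespace Summit.QuantumAdvantage.QuantumAdvantage.Cruxes.WbwVerifiableLineNoSpeedup.Disproof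

open Literature.Computability.Cryptography Literature.Computability.QuantumComplexity
  Literature.Computability.Complexity
open Summit.QuantumAdvantage.QuantumAdvantage.Theses.WhiteBoxWalk (WbwVerifiableLineNoSpeedup)

/-! ## §0 The crux over the named tables -/

/-- The quantity bounded by the crux: the bounded-error quantum query complexity of the sink bit
of black-box SVL with `m`-bit names and `T` steps. -/
abbrev svlQ (m T : ℕ) : ℕ := quantumQueryComplexityOn (1 / 3) (svlPromise m T) (svlSinkBit m T)

/-- The generic shape of the crux and of its mutations: a lower bound `c · g(m,T) / m ≤ Q` under a
hypothesis set `H`. -/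
def LowerBound (H : ℕ → ℕ → Prop) (g : ℕ → ℕ → ℝ) : Prop :=
  ∃ c : ℝ, 0 < c ∧ ∀ m T : ℕ, H m T → c * g m T / m ≤ (svlQ m T : ℝ)

/-- The crux's hypothesis set. -/
def cruxHyps (m T : ℕ) : Prop := 2 ≤ m ∧ 1 ≤ T ∧ T + 1 ≤ 2 ^ (m - 1)

/-- The crux's growth function `min (T+1) √(2^m)`. -/
def cruxFn (m T : ℕ) : ℝ := min ((T : ℝ) + 1) (Real.sqrt (2 ^ m))

/-- The crux is, by `Iff.rfl`, the statement over `svlPromise` / `svlSinkBit`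
(`svlPromise_eq`, `svlSinkBit_eq` are `rfl`). -/
theorem crux_iff :
    WbwVerifiableLineNoSpeedup ↔
      ∃ c : ℝ, 0 < c ∧ ∀ m T : ℕ, 2 ≤ m → 1 ≤ T → T + 1 ≤ 2 ^ (m - 1) →
        c * min ((T : ℝ) + 1) (Real.sqrt (2 ^ m)) / m ≤ (svlQ m T : ℝ) :=
  Iff.rfl

/-- The crux in the generic shape `LowerBound cruxHyps cruxFn`. -/
theorem crux_iff_lowerBound : WbwVerifiableLineNoSpeedup ↔ LowerBound cruxHyps cruxFn := by
  rw [crux_iff]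
  unfold LowerBound cruxHyps cruxFn
  constructor
  · rintro ⟨c, hc, h⟩
    exact ⟨c, hc, fun m T hH => h m T hH.1 hH.2.1 hH.2.2⟩
  · rintro ⟨c, hc, h⟩
    exact ⟨c, hc, fun m T h1 h2 h3 => h m T ⟨h1, h2, h3⟩⟩

/-! ## §1 Hypothesis bookkeeping -/

/-- The hypothesis `2 ≤ m` of the crux is implied by the other two (`m = 0, 1` force `T = 0`):
it is decoration. -/
theorem two_le_of_hyps {m T : ℕ} (hT : 1 ≤ T) (hTm : T + 1 ≤ 2 ^ (m - 1)) : 2 ≤ m := by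
  rcases Nat.lt_or_ge m 2 with hm | hm
  · interval_cases m <;> simp at hTm <;> omega
  · exact hm

/-- Under the crux's hypotheses there is room for a sink of either parity: `T + 2 ≤ 2^m`. -/
theorem succ_succ_le_two_pow_of_hyps {m T : ℕ} (hT : 1 ≤ T) (hTm : T + 1 ≤ 2 ^ (m - 1)) :
    T + 2 ≤ 2 ^ m := by
  have hm := two_le_of_hyps hT hTm
  have h2 : 2 ^ m = 2 * 2 ^ (m - 1) := by
    rw [← Nat.pow_succ']
    congr 1
    omega
  have h1 : 1 ≤ 2 ^ (m - 1) := Nat.one_le_two_pow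
  omega

/-- In particular `T + 1 ≤ 2^m` (the promise set is nonempty, `svlPromise_nonempty`). -/
theorem succ_le_two_pow_of_hyps {m T : ℕ} (hT : 1 ≤ T) (hTm : T + 1 ≤ 2 ^ (m - 1)) :
    T + 1 ≤ 2 ^ m :=
  (Nat.le_succ _).trans (succ_succ_le_two_pow_of_hyps hT hTm)

/-! ## §2 Zero-query algorithms; the two load-bearing hypotheses -/

/-- The input length `2^m·m + 2^m·(T+1)` is positive. -/
theorem inputLen_pos (m T : ℕ) : 0 < 2 ^ m * m + 2 ^ m * (T + 1) :=
  Nat.add_pos_right _ (Nat.mul_pos (Nat.two_pow_pos m) (Nat.succ_pos T))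

instance (m T : ℕ) : NeZero (2 ^ m * m + 2 ^ m * (T + 1)) := ⟨(inputLen_pos m T).ne'⟩

/-- The zero-query algorithm that rejects everything. -/
def constAlg (N : ℕ) [NeZero N] : QQueryAlg N where
  W := Unit
  queries := 0
  unitaries := fun _ => 1
  start := (0, false, ())
  accept := ∅

/-- `constAlg` never accepts. -/
theorem constAlg_acceptProb (N : ℕ) [NeZero N] (x : Fin N → Bool) :
    (constAlg N).acceptProb x = 0 := by
  classical
  unfold QQueryAlg.acceptProb
  refine Finset.sum_eq_zero fun s hs => ?_
  rw [Finset.mem_filter] at hs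
  exact absurd hs.2 (Set.notMem_empty s)

/-- A function that is `false` on all of `D` has `Q_ε(D, f) = 0` for every `ε ≥ 0`
(zero queries: reject). -/
theorem quantumQueryComplexityOn_eq_zero_of_forall_eq_false {N : ℕ} [NeZero N] {ε : ℝ}
    (hε : 0 ≤ ε) {D : Set (Fin N → Bool)} {f : (Fin N → Bool) → Bool}
    (hf : ∀ x ∈ D, f x = false) : quantumQueryComplexityOn ε D f = 0 := by
  apply Nat.eq_zero_of_le_zero
  refine Nat.sInf_le ⟨constAlg N, rfl, fun x hx => ⟨fun hfx => ?_, fun _ => ?_⟩⟩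
  · rw [hf x hx] at hfx
    exact absurd hfx Bool.false_ne_true
  · rw [constAlg_acceptProb]
    exact hε

/-- On the EMPTY promise set every function has `Q_ε = 0` (`ε ≥ 0`). -/
theorem quantumQueryComplexityOn_empty {N : ℕ} [NeZero N] {ε : ℝ} (hε : 0 ≤ ε)
    (f : (Fin N → Bool) → Bool) : quantumQueryComplexityOn ε (∅ : Set (Fin N → Bool)) f = 0 :=
  quantumQueryComplexityOn_eq_zero_of_forall_eq_false hε fun _ h => absurd h (Set.notMem_empty _)

/-- A zero-query algorithm has an input-independent final state. -/
theorem finalState_eq_of_queries_eq_zero {N : ℕ} (A : QQueryAlg N) (h : A.queries = 0)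
    (x y : Fin N → Bool) : A.finalState x = A.finalState y := by
  cases A with
  | mk W q U s acc =>
    simp only at h
    subst h
    simp [QQueryAlg.finalState]

/-- A zero-query algorithm has an input-independent acceptance probability. -/
theorem acceptProb_eq_of_queries_eq_zero {N : ℕ} (A : QQueryAlg N) (h : A.queries = 0)
    (x y : Fin N → Bool) : A.acceptProb x = A.acceptProb y := by
  unfold QQueryAlg.acceptProb
  rw [finalState_eq_of_queries_eq_zero A h x y]

/-- If `f` takes both values on `D` then no zero-query algorithm computes it with error `< 1/2`;
in particular `1 ≤ Q_{1/3}(D, f)` (the defining infimum is attained,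
`exists_queries_eq_quantumQueryComplexityOn`). -/
theorem one_le_quantumQueryComplexityOn_of_nonconst {N : ℕ} [NeZero N] {D : Set (Fin N → Bool)}
    {f : (Fin N → Bool) → Bool} {x₀ x₁ : Fin N → Bool} (hx₀ : x₀ ∈ D) (hx₁ : x₁ ∈ D)
    (hf₀ : f x₀ = false) (hf₁ : f x₁ = true) : 1 ≤ quantumQueryComplexityOn (1 / 3) D f := by
  by_contra hlt
  push Not at hlt
  have h0 : quantumQueryComplexityOn (1 / 3) D f = 0 := Nat.lt_one_iff.1 hlt
  obtain ⟨A, hAq, hA⟩ :=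
    exists_queries_eq_quantumQueryComplexityOn (by norm_num : (0 : ℝ) ≤ 1 / 3) D f
  rw [h0] at hAq
  have h1 := (hA x₁ hx₁).1 hf₁
  have h2 := (hA x₀ hx₀).2 hf₀
  rw [acceptProb_eq_of_queries_eq_zero A hAq x₁ x₀] at h1
  linarith

/-- At `T = 0` the sink is the source `x₀ = 0`, so the sink bit is `false` on the whole promise. -/
theorem svlSinkBit_eq_false_of_T_zero {m : ℕ} {t : SVLInput m 0} (ht : t ∈ svlPromise m 0) :
    svlSinkBit m 0 t = false := by
  obtain ⟨xs, hxs⟩ := ht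
  rw [hxs.svlSinkBit_eq, show Fin.last 0 = 0 from rfl, hxs.source]
  decide

/-- Hence `Q(m, 0) = 0` for every `m`. -/
theorem svlQ_zero_right (m : ℕ) : svlQ m 0 = 0 :=
  quantumQueryComplexityOn_eq_zero_of_forall_eq_false (by norm_num) fun _ ht =>
    svlSinkBit_eq_false_of_T_zero ht

/-- And `Q(m, T) = 0` whenever `2^m < T + 1` (empty promise). -/
theorem svlQ_eq_zero_of_two_pow_lt {m T : ℕ} (h : 2 ^ m < T + 1) : svlQ m T = 0 := by
  unfold svlQ
  rw [svlPromise_eq_empty h]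
  exact quantumQueryComplexityOn_empty (by norm_num) _

/-- The crux WITHOUT the hypothesis `1 ≤ T`. -/
def WbwVerifiableLineNoSpeedupWithoutTpos : Prop :=
  ∃ c : ℝ, 0 < c ∧ ∀ m T : ℕ, 2 ≤ m → T + 1 ≤ 2 ^ (m - 1) →
    c * min ((T : ℝ) + 1) (Real.sqrt (2 ^ m)) / m ≤ (svlQ m T : ℝ)

/-- The crux WITHOUT the hypothesis `T + 1 ≤ 2^(m-1)`. -/
def WbwVerifiableLineNoSpeedupWithoutTbound : Prop :=
  ∃ c : ℝ, 0 < c ∧ ∀ m T : ℕ, 2 ≤ m → 1 ≤ T →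
    c * min ((T : ℝ) + 1) (Real.sqrt (2 ^ m)) / m ≤ (svlQ m T : ℝ)

/-- **Load-bearing: `1 ≤ T`.** Without it the statement is false: witness `(m, T) = (2, 0)`,
where `Q = 0` but `c · min 1 2 / 2 = c/2 > 0`. Any proof must use `1 ≤ T` (it is what makes the
sink bit non-constant). -/
theorem wbwVerifiableLineNoSpeedup_false_without_Tpos : ¬ WbwVerifiableLineNoSpeedupWithoutTpos := by
  rintro ⟨c, hc, h⟩
  have h20 := h 2 0 le_rfl (by norm_num)
  rw [svlQ_zero_right] at h20
  have hs : Real.sqrt (2 ^ 2) = 2 := Real.sqrt_sq (by norm_num)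
  have hmin : min ((0 : ℕ) + 1 : ℝ) (Real.sqrt (2 ^ 2)) = 1 := by
    rw [hs]
    exact (min_eq_left (by norm_num)).trans (by norm_num)
  rw [hmin] at h20
  norm_num at h20
  linarith

/-- **Load-bearing: `T + 1 ≤ 2^(m-1)`** (in the weak sense that SOME upper bound `T + 1 ≤ 2^m` is
needed). Without it the statement is false: witness `(m, T) = (2, 4)`, where the promise set is
empty (no simple line with `5` vertices among `4` names), `Q = 0`, but `c · min 5 2 / 2 = c > 0`. -/
theorem wbwVerifiableLineNoSpeedup_false_without_Tbound :
    ¬ WbwVerifiableLineNoSpeedupWithoutTbound := by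
  rintro ⟨c, hc, h⟩
  have h24 := h 2 4 le_rfl (by norm_num)
  rw [svlQ_eq_zero_of_two_pow_lt (by norm_num)] at h24
  have hs : Real.sqrt (2 ^ 2) = 2 := Real.sqrt_sq (by norm_num)
  have hmin : min ((4 : ℕ) + 1 : ℝ) (Real.sqrt (2 ^ 2)) = 2 := by
    rw [hs]
    exact min_eq_right (by norm_num)
  rw [hmin] at h24
  norm_num at h24
  linarith

/-! ## §3 The pointwise weakening holds: `Q ≥ 1` under the hypotheses -/

/-- The successor table of the line `xs`: `S(xs i) = xs (i+1)` for `i < T`, identity elsewhere. -/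
def lineSucc {m T : ℕ} (xs : Fin (T + 1) → Fin (2 ^ m)) (x : Fin (2 ^ m)) : Fin (2 ^ m) :=
  if h : ∃ i : Fin T, xs i.castSucc = x then xs (Classical.choose h).succ else x

/-- The input `(S, V)` of the line `xs`. -/
def lineInput {m T : ℕ} (xs : Fin (T + 1) → Fin (2 ^ m)) : SVLInput m T :=
  svlInput m T (lineSucc xs) fun x i => decide (x = xs i)

/-- For an injective `xs` with `xs 0 = 0`, `lineInput xs` is in the promise set with line `xs`. -/
theorem isSvlLine_lineInput {m T : ℕ} {xs : Fin (T + 1) → Fin (2 ^ m)}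
    (hinj : Function.Injective xs) (h0 : (xs 0).val = 0) : IsSvlLine (lineInput xs) xs := by
  rw [isSvlLine_iff]
  refine ⟨hinj, h0, fun i => ?_, fun x i => ?_⟩
  · rw [lineInput, svlSucc_svlInput, lineSucc]
    have hex : ∃ i' : Fin T, xs i'.castSucc = xs i.castSucc := ⟨i, rfl⟩
    rw [dif_pos hex]
    have hi : Classical.choose hex = i := by
      have := Classical.choose_spec hex
      exact Fin.castSucc_injective _ (hinj this)
    rw [hi]
  · rw [lineInput, svlVerify_svlInput]

/-- Hence `lineInput xs ∈ svlPromise m T`. -/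
theorem lineInput_mem {m T : ℕ} {xs : Fin (T + 1) → Fin (2 ^ m)}
    (hinj : Function.Injective xs) (h0 : (xs 0).val = 0) : lineInput xs ∈ svlPromise m T :=
  ⟨xs, isSvlLine_lineInput hinj h0⟩

/-- And its sink bit is the parity of `xs T`. -/
theorem svlSinkBit_lineInput {m T : ℕ} {xs : Fin (T + 1) → Fin (2 ^ m)}
    (hinj : Function.Injective xs) (h0 : (xs 0).val = 0) :
    svlSinkBit m T (lineInput xs) = decide ((xs (Fin.last T)).val % 2 = 1) :=
  (isSvlLine_lineInput hinj h0).svlSinkBit_eq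

/-- The bent line `0, 1, …, T-1, T+1` (requires `T + 2 ≤ 2^m`). -/
def bentLine {m T : ℕ} (h : T + 2 ≤ 2 ^ m) (i : Fin (T + 1)) : Fin (2 ^ m) :=
  if i = Fin.last T then ⟨T + 1, by omega⟩ else ⟨i.val, by omega⟩

theorem bentLine_injective {m T : ℕ} (h : T + 2 ≤ 2 ^ m) : Function.Injective (bentLine h) := by
  intro i j hij
  unfold bentLine at hij
  by_cases hi : i = Fin.last T <;> by_cases hj : j = Fin.last T
  · rw [hi, hj]
  · rw [if_pos hi, if_neg hj] at hij
    have := Fin.mk.inj_iff.1 hij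
    have hj' := j.isLt
    omega
  · rw [if_neg hi, if_pos hj] at hij
    have := Fin.mk.inj_iff.1 hij
    have hi' := i.isLt
    omega
  · rw [if_neg hi, if_neg hj] at hij
    exact Fin.ext (Fin.mk.inj_iff.1 hij)

theorem bentLine_zero {m T : ℕ} (h : T + 2 ≤ 2 ^ m) (hT : 1 ≤ T) : (bentLine h 0).val = 0 := by
  have h0 : (0 : Fin (T + 1)) ≠ Fin.last T := by
    intro h0
    have := congrArg Fin.val h0
    simp at this
    omega
  simp [bentLine, h0]

theorem bentLine_last {m T : ℕ} (h : T + 2 ≤ 2 ^ m) : (bentLine h (Fin.last T)).val = T + 1 := by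
  simp [bentLine]

/-- **`Q ≥ 1` pointwise.** For `1 ≤ T` and `T + 2 ≤ 2^m` (implied by the crux's hypotheses) the
sink bit takes both values on the promise (straight line ends at `T`, bent line at `T + 1`), so
no zero-query algorithm computes it: `1 ≤ Q_{1/3}`. -/
theorem one_le_svlQ {m T : ℕ} (hT : 1 ≤ T) (h : T + 2 ≤ 2 ^ m) : 1 ≤ svlQ m T := by
  have hs : T + 1 ≤ 2 ^ m := (Nat.le_succ _).trans h
  -- straight line: sink `T`; bent line: sink `T + 1`
  have hA := lineInput_mem (m := m) (xs := svlStraightLine hs)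
    (fun i j hij => Fin.ext (Fin.mk.inj_iff.1 hij)) rfl
  have hAbit := svlSinkBit_lineInput (m := m) (xs := svlStraightLine hs)
    (fun i j hij => Fin.ext (Fin.mk.inj_iff.1 hij)) rfl
  have hB := lineInput_mem (bentLine_injective h) (bentLine_zero h hT)
  have hBbit := svlSinkBit_lineInput (bentLine_injective h) (bentLine_zero h hT)
  rw [bentLine_last] at hBbit
  have hlastA : (svlStraightLine hs (Fin.last T)).val = T := rfl
  rw [hlastA] at hAbit
  rcases Nat.even_or_odd T with hev | hodd
  · -- T even: straight line gives `false`, bent line gives `true`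
    rw [Nat.even_iff] at hev
    refine one_le_quantumQueryComplexityOn_of_nonconst hA hB ?_ ?_
    · rw [hAbit, decide_eq_false_iff_not]
      omega
    · rw [hBbit, decide_eq_true_iff]
      omega
  · rw [Nat.odd_iff] at hodd
    refine one_le_quantumQueryComplexityOn_of_nonconst hB hA ?_ ?_
    · rw [hBbit, decide_eq_false_iff_not]
      omega
    · rw [hAbit, decide_eq_true_iff]
      omega

/-- `Q ≥ 1` under the crux's literal hypotheses. -/
theorem one_le_svlQ_of_hyps {m T : ℕ} (hT : 1 ≤ T) (hTm : T + 1 ≤ 2 ^ (m - 1)) : 1 ≤ svlQ m T :=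
  one_le_svlQ hT (succ_succ_le_two_pow_of_hyps hT hTm)

/-- **The quantifier-swapped weakening of the crux is TRUE**: for each admissible `(m, T)` there
is a `c > 0` with `c · min (T+1) √(2^m) / m ≤ Q` (take `c = m/(T+1)` and use `Q ≥ 1`). Hence no
finite set of parameters can refute the crux; any disproof is an asymptotic algorithm. -/
theorem pointwise_bound (m T : ℕ) (hm : 2 ≤ m) (hT : 1 ≤ T) (hTm : T + 1 ≤ 2 ^ (m - 1)) :
    ∃ c : ℝ, 0 < c ∧ c * min ((T : ℝ) + 1) (Real.sqrt (2 ^ m)) / m ≤ (svlQ m T : ℝ) := by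
  have hQ : (1 : ℝ) ≤ (svlQ m T : ℝ) := by exact_mod_cast one_le_svlQ_of_hyps hT hTm
  have hmpos : (0 : ℝ) < m := by exact_mod_cast (lt_of_lt_of_le (by norm_num) hm)
  have hT1 : (0 : ℝ) < (T : ℝ) + 1 := by positivity
  refine ⟨m / ((T : ℝ) + 1), by positivity, ?_⟩
  calc m / ((T : ℝ) + 1) * min ((T : ℝ) + 1) (Real.sqrt (2 ^ m)) / m
      ≤ m / ((T : ℝ) + 1) * ((T : ℝ) + 1) / m := by
        gcongr
        exact min_le_left _ _
    _ = 1 := by field_simp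
    _ ≤ (svlQ m T : ℝ) := hQ

/-! ## §4 Tightness of the walk branch; the Grover branch alone is refuted -/

/-- **Walk upper bound** `Q ≤ m · T` (follow the line: the tree's `svlLineTree`, then
`Q_{1/3} ≤ R_{1/3} ≤ D`). So the crux is within a factor `m²/c` of optimal whenever
`T + 1 ≤ √(2^m)`. -/
theorem svlQ_le_mul (m T : ℕ) : svlQ m T ≤ m * T :=
  (quantumQueryComplexityOn_le_randQueryComplexityOn (by norm_num) _ _).trans
    (randQueryComplexityOn_svlPromise_le m T (by norm_num))

/-- The one-query tree reading bit `0` of `S(0)`, i.e. the parity of `x₁`. -/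
def bitZeroTree (m : ℕ) (hm : 1 ≤ m) : DecisionTree (2 ^ m * m + 2 ^ m * (1 + 1)) :=
  .query (svlSuccIndex m 1 ⟨0, Nat.two_pow_pos m⟩ ⟨0, hm⟩) (.leaf false) (.leaf true)

theorem bitZeroTree_depth (m : ℕ) (hm : 1 ≤ m) : (bitZeroTree m hm).depth = 1 := by
  simp [bitZeroTree, DecisionTree.depth]

/-- At `T = 1` the sink bit is bit `0` of `S(0)`: the one-query tree computes it on the promise. -/
theorem bitZeroTree_computesOn (m : ℕ) (hm : 1 ≤ m) :
    (bitZeroTree m hm).ComputesOn (svlPromise m 1) (svlSinkBit m 1) := by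
  rintro t ⟨xs, hxs⟩
  have h0 : (⟨0, Nat.two_pow_pos m⟩ : Fin (2 ^ m)) = xs (0 : Fin 1).castSucc :=
    Fin.ext (by simpa using hxs.source.symm)
  have hbit := hxs.2.2.1 0 ⟨0, hm⟩
  rw [← h0] at hbit
  rw [hxs.svlSinkBit_eq, show Fin.last 1 = (0 : Fin 1).succ from rfl, ← Nat.testBit_zero]
  change (DecisionTree.query _ _ _).eval t = _
  rw [DecisionTree.eval]
  unfold svlSuccBit at hbit
  rw [hbit]
  cases (xs (Fin.succ 0)).val.testBit 0 <;> rfl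

/-- **`Q(m, 1) ≤ 1`**: one classical query suffices at `T = 1`. -/
theorem svlQ_one_le_one {m : ℕ} (hm : 1 ≤ m) : svlQ m 1 ≤ 1 := by
  have hD : detQueryComplexityOn (svlPromise m 1) (svlSinkBit m 1) ≤ 1 :=
    (detQueryComplexityOn_le_depth _ (bitZeroTree_computesOn m hm)).trans
      (bitZeroTree_depth m hm).le
  exact ((quantumQueryComplexityOn_le_randQueryComplexityOn (by norm_num) _ _).trans
    (randQueryComplexityOn_le_det (by norm_num) _ _)).trans hD

/-- Hence `Q(m, 1) = 1` for `m ≥ 2`. -/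
theorem svlQ_one_eq_one {m : ℕ} (hm : 2 ≤ m) : svlQ m 1 = 1 := by
  refine le_antisymm (svlQ_one_le_one (by omega)) (one_le_svlQ le_rfl ?_)
  calc 1 + 2 = 3 := rfl
    _ ≤ 2 ^ 2 := by norm_num
    _ ≤ 2 ^ m := Nat.pow_le_pow_right (by norm_num) hm

/-- **Every admissible constant is `≤ 1`**: at `(m, T) = (2, 1)` the crux reads
`c · min 2 2 / 2 = c ≤ Q(2, 1) = 1`. (So the crux, if true, is true with a small absolute `c`;
nothing is hidden in the constant.) -/
theorem admissible_const_le_one {c : ℝ}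
    (h : ∀ m T : ℕ, 2 ≤ m → 1 ≤ T → T + 1 ≤ 2 ^ (m - 1) →
      c * min ((T : ℝ) + 1) (Real.sqrt (2 ^ m)) / m ≤ (svlQ m T : ℝ)) : c ≤ 1 := by
  have h21 := h 2 1 le_rfl le_rfl (by norm_num)
  rw [svlQ_one_eq_one le_rfl] at h21
  have hs : Real.sqrt (2 ^ 2) = 2 := Real.sqrt_sq (by norm_num)
  have hmin : min ((1 : ℕ) + 1 : ℝ) (Real.sqrt (2 ^ 2)) = 2 := by
    rw [hs]
    exact (min_eq_left (by norm_num)).trans (by norm_num)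
  rw [hmin] at h21
  norm_num at h21
  exact h21

/-- `k³ ≤ 2^k` for `k ≥ 10`. -/
theorem cube_le_two_pow {k : ℕ} (hk : 10 ≤ k) : k ^ 3 ≤ 2 ^ k := by
  induction k, hk using Nat.le_induction with
  | base => norm_num
  | succ k hk ih =>
    have h1 : 3 * k ^ 2 + 3 * k + 1 ≤ k ^ 3 := by
      have hk2 : 10 * k ≤ k ^ 2 := by nlinarith
      have hk3 : 10 * k ^ 2 ≤ k ^ 3 := by nlinarith
      linarith
    calc (k + 1) ^ 3 = k ^ 3 + (3 * k ^ 2 + 3 * k + 1) := by ring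
      _ ≤ k ^ 3 + k ^ 3 := Nat.add_le_add_left h1 _
      _ ≤ 2 ^ k + 2 ^ k := Nat.add_le_add ih ih
      _ = 2 ^ (k + 1) := by ring

/-- The strengthening of the crux in which the `min` is replaced by its GROVER branch alone. -/
def GroverBranchOnly : Prop :=
  ∃ c : ℝ, 0 < c ∧ ∀ m T : ℕ, 2 ≤ m → 1 ≤ T → T + 1 ≤ 2 ^ (m - 1) →
    c * Real.sqrt (2 ^ m) / m ≤ (svlQ m T : ℝ)

/-- **Refuted strengthening: the walk branch of the `min` is necessary.** `¬ GroverBranchOnly`: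
at `T = 1`, `Q(m, 1) ≤ 1` for all `m`, while `c · √(2^m) / m → ∞` (take `m = 2k`, `k ≥ 10`,
`k > 4/c`: `c · 2^k ≤ (2k)·1`… contradiction via `k³ ≤ 2^k`). -/
theorem not_groverBranchOnly : ¬ GroverBranchOnly := by
  rintro ⟨c, hc, h⟩
  -- choose k ≥ 10 with c * k > 2
  obtain ⟨k, hk⟩ := exists_nat_gt (max 10 (2 / c))
  have hk10 : 10 ≤ k := by
    have : (10 : ℝ) < k := lt_of_le_of_lt (le_max_left _ _) hk
    exact_mod_cast this.le
  have hkc : 2 / c < k := lt_of_le_of_lt (le_max_right _ _) hk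
  have hkpos : (0 : ℝ) < k := by exact_mod_cast (lt_of_lt_of_le (by norm_num) hk10)
  -- the crux's hypotheses at (m, T) = (2k, 1)
  have hm : 2 ≤ 2 * k := by omega
  have hTm : 1 + 1 ≤ 2 ^ (2 * k - 1) := by
    calc 1 + 1 = 2 ^ 1 := rfl
      _ ≤ 2 ^ (2 * k - 1) := Nat.pow_le_pow_right (by norm_num) (by omega)
  have hQ := h (2 * k) 1 hm le_rfl hTm
  have hQ1 : (svlQ (2 * k) 1 : ℝ) ≤ 1 := by exact_mod_cast svlQ_one_le_one (m := 2 * k) (by omega)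
  -- √(2^(2k)) = 2^k ≥ k³
  have hsqrt : Real.sqrt (2 ^ (2 * k)) = (2 : ℝ) ^ k := by
    have h22 : (2 : ℝ) ^ (2 * k) = ((2 : ℝ) ^ k) ^ 2 := by rw [← pow_mul, mul_comm]
    rw [h22]
    exact Real.sqrt_sq (by positivity)
  have hcube : (k : ℝ) ^ 3 ≤ (2 : ℝ) ^ k := by exact_mod_cast cube_le_two_pow hk10
  rw [hsqrt] at hQ
  have hm' : ((2 * k : ℕ) : ℝ) = 2 * k := by norm_num
  rw [hm'] at hQ
  -- c * 2^k / (2k) ≤ 1 but c * k^3 / (2k) = c k² / 2 > 1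
  have h1 : c * (k : ℝ) ^ 3 / (2 * k) ≤ 1 := by
    calc c * (k : ℝ) ^ 3 / (2 * k) ≤ c * (2 : ℝ) ^ k / (2 * k) := by gcongr
      _ ≤ (svlQ (2 * k) 1 : ℝ) := hQ
      _ ≤ 1 := hQ1
  have h2 : c * (k : ℝ) ^ 3 / (2 * k) = c * k * k / 2 := by
    rw [div_eq_div_iff (mul_ne_zero two_ne_zero hkpos.ne') two_ne_zero]
    ring
  rw [h2] at h1
  have hck : 2 < c * k := by
    have := (div_lt_iff₀ hc).1 hkc
    linarith
  have hk1 : (1 : ℝ) ≤ k := by exact_mod_cast (le_trans (by norm_num) hk10)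
  nlinarith

/-! ## §5 Grover-branch tightness (PROVED; landed separately) -/

/-- **Grover-branch tightness — PROVED** (scratch `Combined.lean` rc 0; landing as
`Theorems/WbwVerifiableLineNoSpeedup/Negative/GroverTight.lean` once `Negative/QueryReindex.lean`
(p74512) is in the tree): `Q_{1/3}(SVL_{m,T}) ≤ 76 √(2^(m-1))` for `m ≥ 1` — the sink bit IS
`orFn` of the `2^(m-1)` bits `V(x,T)`, `x` odd, so the bit-copy reduction
(`QueryReindex.quantumQueryComplexityOn_le_of_reindex`, source map
`y ↦ svlVerifyIndex m T (2y+1) (Fin.last T)`) and the tree's `quantumQueryComplexity_orFn_le`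
(Grover, `Q₂(OR_N) ≤ 76 √N`) give it. Consequences (also proved there): `Q ≤ 54 √(2^m)`;
`not_walkBranchOnly : ¬ ∃ c > 0, ∀ m T, hyps → c (T+1)/m ≤ Q` (witness `m = 2k+1`,
`T = 4^k - 1`). Recorded here as a statement. -/
def GroverBranchTight : Prop :=
  ∀ m T : ℕ, 1 ≤ m → (svlQ m T : ℝ) ≤ 76 * Real.sqrt (2 ^ (m - 1))

/-! ## §7 Proof route found while attacking (for the provers)

The attacks of §6 kept failing for one reason: every way of putting amplitude on an unknown line
vertex costs either a walk step or a `√N`-type search. The adversary method makes this precise and,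
on paper, PROVES the crux. Everything below is in the name-query picture for readability; the
counts are per ROW for S (a bit of a row is touched by at most as many partners as the row) and per
ENTRY for V, so they transfer verbatim to the tree's bit-query model.

### 7.1 Instance family and relation (Ambainis 2002, Thm 6 — weighted relational adversary)
`N = 2^m`. Family `P'_T` = inputs `(S, V)` where `S` is a PERMUTATION of `[N]` ALL of whose cycles
have length `> T`, the line is `x_i = S^i(0)` (`i ≤ T`, automatically simple) and `V(x,i) = [x = x_i]`.
`X = {parity(x_T) = 0}`, `Y = {parity(x_T) = 1}`. Relation `R ⊆ X × Y`: `(S, S')` related iff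
`S'` is `S` with the OUTPUTS OF TWO ROWS `u = x_k` (`k < T`) and `v ≠ u` swapped
(`S'(x_k) = S(v)`, `S'(v) = x_{k+1}`), both in `P'_T`, paths agreeing up to `k` (first divergence at
`k+1`). Two types: `v` on another cycle (MERGE: cycles merge, stays in `P'_T`), or `v = x_q` on the
`0`-cycle with both pieces `> T` (SPLIT).
COUNTS (validated by brute force: `compute/adv_check.py`, kit job j008991 — exhaustive over `S_8`
for `T = 1,2,3`, sampled for `N = 16, 32, 64`, zero violations):
* degrees: every `S ∈ X` has `≥ T · #{odd names ∉ {x_0..x_{2T}}} ≥ T(N/2 - 2T - 1)` partners in `Y`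
  (for each `k < T` the new sinks of the merge partners run through all off-cycle vertices once,
  those of the split partners through `x_{2T+1}, …, x_{L-1}`); symmetrically for `Y`. So
  `m = m' ≥ T(N/2 - 2T - 1) ≥ TN/8` when `8T ≤ N`.
* S-rows: for any instance and row `a`, at most `N + T` partners differ at row `a` (`a = x_k`: any
  `v`; `a` as the `v` of another `k'`: `≤ T`). Product `≤ (N+T)² ≤ (9N/8)²`.
* V-entries `(x, i)`: the side having `x` as `i`-th vertex has `≤ TN` partners at all; the other
  side has `≤ 2T` partners ACQUIRING `x` as `i`-th vertex (for each `k < i` at most one merge-`v`,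
  `v = S^{-(i-k)}(x)`, and one split-`q`; long cycles exclude the "absorb a short cycle and shift"
  multiplicity that breaks the count for general permutations — this is WHY the family has all
  cycles `> T`; brute force even shows `≤ T`). Product `≤ 2T²N`.
Hence `ℓ_max ≤ max((9N/8)², 2T²N)` and Ambainis's Theorem 6 gives
`Q_{1/3} ≥ c₀ √(m m'/ℓ_max) ≥ c₀ (TN/8)/max(9N/8, T√(2N)) ≥ (c₀/12) · min(T, √N)` for `8T ≤ N`,
`c₀ > 0` the absolute constant of the theorem at error `1/3`. This is `SvlAdversarySmallT` below.
The "verified jumping" worry of the item is exactly the V-entry term `T√(2N)`: it caps the bound at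
`√N` (Grover on a column of `V` IS possible) and costs nothing more.

### 7.2 Padding (the regime `N/8 < T ≤ N/2 - 1`)
`Q(m+1, T) ≥ Q(m, T')` for `T' < T ≤ 2^m` (PROVED, see `PaddingMonotone`): an `(m, T')` instance `t` on names `[N]` becomes an
`(m+1, T)` instance on names `[2N] = {low half} ∪ {high half}`: line
`0, 1, …, T-T'-1` (fresh, low half) `→ N + x_0 = N → N + x_1 → … → N + x_{T'}` (the old line
shifted to the high half; `N + x` has the parity of `x`, and `T - T' ≤ N` fits in the low half);
`S_new(N + x) = N + S(x)`, `V_new(N + x, i) = V(x, i - (T - T'))`, fresh rows/entries constant.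
Every bit of the new table is a COPY of an old bit or a CONSTANT, and the two constants can
themselves be copied from old bits that are constant ON THE PROMISE (`V(0,0) = 1`, `V(1,0) = 0`),
so the only algorithmic lemma needed is PURE RE-INDEXING: for `src : Fin N₁ → Fin N₀` and
`A : QQueryAlg N₁` there is `A' : QQueryAlg N₀` with the same number of queries and
`A'.acceptProb t = A.acceptProb (t ∘ src)` (embed the basis `(z,b,w) ↦ (src z, b, (w,z))`, extend the
unitaries by the identity on the complement; the bit-flip oracle commutes with the embedding). The
same lemma gives the Grover-branch tightness of §5. This is `PaddingMonotone` below.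

### 7.3 Assembly (`crux_of_smallT_of_padding`, CHECKED below)
`c := min(κ/2, 1/4)`. If `8T ≤ 2^m`: `κ min(T, √N) ≥ (κ/2) min(T+1, √N)`. Else if `m < 7`:
`c · min(T+1, √N)/m ≤ (1/4)·8/2 = 1 ≤ Q` (§3). Else pad from `(m-1, T' = 2^(m-5))`:
`Q(m,T) ≥ Q(m-1, 2^(m-5)) ≥ κ min(2^(m-5), √(2^(m-1))) ≥ (κ/2) √(2^m)`.

### 7.4 What the tree lacks (work items a planner can file)
(i) `WeightedAdversaryBound` (below): Ambainis 2002 Thm 6 / Høyer–Špalek 2005 Thm 2 with an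
arbitrary nonnegative weight on a relation, for PROMISE problems, in the `QQueryAlg` model — the
tree's `SpectralAdversary.lean` proves only the sensitivity-graph special case for total functions,
but its progress-function proof generalises line by line (replace the matching `Γ_i` by a weighted
bipartite graph and `λ(Γ_i) ≤ 1` by `λ(Γ_i) ≤ √(max row-sum · max col-sum)`). (ii) the re-indexing
lemma of 7.2 — DONE this cycle (`Negative/QueryReindex.lean`, p74512), and with it (ii') `PaddingMonotone`
and the Grover-branch tightness. (iii) the long-cycle permutation combinatorics of 7.1 (finite, brute-force-validated;
the delicate count is the `≤ 2T` one). With (i)+(iii), `SvlAdversarySmallT`; `PaddingMonotone` is done; then `crux_of_smallT_of_padding`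
closes the crux. REMAINING DEBT OF THE ROUTE = (i) + (iii).
-/

/-- **Target A (regime `8T ≤ 2^m`).** The relational-adversary lower bound for black-box SVL on
long-cycle permutation instances: `κ · min(T, √(2^m)) ≤ Q_{1/3}` for an absolute `κ > 0`
(on paper: Ambainis 2002 Thm 6 with the output-transposition relation, §7.1; `κ = c₀/12`). -/
def SvlAdversarySmallT : Prop :=
  ∃ κ : ℝ, 0 < κ ∧ ∀ m T : ℕ, 1 ≤ T → 8 * T ≤ 2 ^ m →
    κ * min (T : ℝ) (Real.sqrt (2 ^ m)) ≤ (svlQ m T : ℝ)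

/-- **Target B (padding monotonicity) — PROVED** (scratch `Combined.lean` rc 0; landing as
`Theorems/WbwVerifiableLineNoSpeedup/Negative/Padding.lean`, `quantumQueryComplexityOn_svl_pad`,
once p74512 is in the tree). An `(m, T')` instance embeds, by copying bits, into an `(m+1, T)`
instance whenever `1 ≤ m` and `T' < T ≤ 2^m` (§7.2: at least one fresh prefix vertex is needed so
that the new source is `0`), so `Q(m, T') ≤ Q(m+1, T)`. -/
def PaddingMonotone : Prop :=
  ∀ m T T' : ℕ, 1 ≤ m → T' < T → T ≤ 2 ^ m → svlQ m T' ≤ svlQ (m + 1) T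

/-- **The generic theorem the tree lacks** (Ambainis, *Quantum lower bounds by quantum arguments*,
JCSS 64 (2002), Thm 6; Høyer–Špalek 2005 Thm 2), stated for the tree's model and PROMISE problems:
if `R ⊆ X × Y` relates `0`-inputs to `1`-inputs of `f` inside the promise `D`, every `x ∈ X` has
`≥ m₀` partners, every `y ∈ Y` has `≥ m₁` partners, and for every related pair and every bit where
they differ the product of the numbers of partners differing there is `≤ ℓ`, then
`κ √(m₀ m₁ / ℓ) ≤ Q_{1/3}(D, f)` for an absolute `κ > 0` (`R` nonempty, else the degree
hypotheses are vacuous and the conclusion false). -/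
def WeightedAdversaryBound : Prop :=
  ∃ κ : ℝ, 0 < κ ∧ ∀ (N : ℕ) (D : Set (Fin N → Bool)) (f : (Fin N → Bool) → Bool)
    (X Y : Finset (Fin N → Bool)) (R : Finset ((Fin N → Bool) × (Fin N → Bool)))
    (m₀ m₁ ℓ : ℝ), 0 < m₀ → 0 < m₁ → 0 < ℓ → R.Nonempty →
    (↑X ⊆ D) → (↑Y ⊆ D) → (∀ x ∈ X, f x = false) → (∀ y ∈ Y, f y = true) →
    (∀ p ∈ R, p.1 ∈ X ∧ p.2 ∈ Y) →
    (∀ x ∈ X, m₀ ≤ ((R.filter fun p => p.1 = x).card : ℝ)) →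
    (∀ y ∈ Y, m₁ ≤ ((R.filter fun p => p.2 = y).card : ℝ)) →
    (∀ p ∈ R, ∀ i : Fin N, p.1 i ≠ p.2 i →
      ((R.filter fun q => q.1 = p.1 ∧ q.2 i ≠ p.1 i).card : ℝ) *
        ((R.filter fun q => q.2 = p.2 ∧ q.1 i ≠ p.2 i).card : ℝ) ≤ ℓ) →
    κ * Real.sqrt (m₀ * m₁ / ℓ) ≤ (quantumQueryComplexityOn (1 / 3) D f : ℝ)

/-- **CHECKED REDUCTION.** Targets A and B imply the crux, with `c = min(κ/2, 1/4)` (§7.3). -/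
theorem crux_of_smallT_of_padding (hA : SvlAdversarySmallT) (hP : PaddingMonotone) :
    WbwVerifiableLineNoSpeedup := by
  obtain ⟨κ, hκ, hA⟩ := hA
  refine ⟨min (κ / 2) (1 / 4), by positivity, fun m T hm hT hTm => ?_⟩
  set c : ℝ := min (κ / 2) (1 / 4) with hc
  have hc2 : c ≤ κ / 2 := min_le_left _ _
  have hc4 : c ≤ 1 / 4 := min_le_right _ _
  have hcpos : 0 < c := by positivity
  have hmR : (2 : ℝ) ≤ m := by exact_mod_cast hm
  have hm1 : (1 : ℝ) ≤ m := by linarith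
  have hQ1 : (1 : ℝ) ≤ (svlQ m T : ℝ) := by exact_mod_cast one_le_svlQ_of_hyps hT hTm
  have hN : (0 : ℝ) < Real.sqrt (2 ^ m) := Real.sqrt_pos.2 (by positivity)
  -- dividing by `m ≥ 1` only helps
  have hdiv : c * min ((T : ℝ) + 1) (Real.sqrt (2 ^ m)) / m ≤
      c * min ((T : ℝ) + 1) (Real.sqrt (2 ^ m)) := by
    rw [div_le_iff₀ (by linarith)]
    have h0 : 0 ≤ c * min ((T : ℝ) + 1) (Real.sqrt (2 ^ m)) := by positivity
    nlinarith
  by_cases h8 : 8 * T ≤ 2 ^ m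
  · -- comfortable regime: adversary bound directly
    refine hdiv.trans ?_
    have hb := hA m T hT h8
    have hmin : min ((T : ℝ) + 1) (Real.sqrt (2 ^ m)) ≤ 2 * min (T : ℝ) (Real.sqrt (2 ^ m)) := by
      have hT1 : (1 : ℝ) ≤ T := by exact_mod_cast hT
      rcases le_total (T : ℝ) (Real.sqrt (2 ^ m)) with h | h
      · rw [min_eq_left h]
        calc min ((T : ℝ) + 1) (Real.sqrt (2 ^ m)) ≤ (T : ℝ) + 1 := min_le_left _ _
          _ ≤ 2 * T := by linarith
      · rw [min_eq_right h]
        calc min ((T : ℝ) + 1) (Real.sqrt (2 ^ m)) ≤ Real.sqrt (2 ^ m) := min_le_right _ _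
          _ ≤ 2 * Real.sqrt (2 ^ m) := by linarith
    calc c * min ((T : ℝ) + 1) (Real.sqrt (2 ^ m))
        ≤ (κ / 2) * (2 * min (T : ℝ) (Real.sqrt (2 ^ m))) := by
          gcongr
      _ = κ * min (T : ℝ) (Real.sqrt (2 ^ m)) := by ring
      _ ≤ (svlQ m T : ℝ) := hb
  · push Not at h8
    -- large-T regime
    by_cases hm7 : m < 7
    · -- finitely many name lengths: `min ≤ √(2^m) ≤ √64 = 8`, `m ≥ 2`, `c ≤ 1/4`, and `Q ≥ 1`
      have hsq : Real.sqrt (2 ^ m) ≤ 8 := by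
        have : (2 : ℝ) ^ m ≤ 2 ^ 6 := pow_le_pow_right₀ (by norm_num) (by omega)
        calc Real.sqrt (2 ^ m) ≤ Real.sqrt (2 ^ 6) := Real.sqrt_le_sqrt this
          _ = 8 := by
            rw [show ((2 : ℝ) ^ 6) = 8 ^ 2 by norm_num]
            exact Real.sqrt_sq (by norm_num)
      have hnum : c * min ((T : ℝ) + 1) (Real.sqrt (2 ^ m)) ≤ 2 := by
        calc c * min ((T : ℝ) + 1) (Real.sqrt (2 ^ m)) ≤ (1 / 4) * 8 := by
              gcongr
              exact (min_le_right _ _).trans hsq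
          _ = 2 := by norm_num
      calc c * min ((T : ℝ) + 1) (Real.sqrt (2 ^ m)) / m ≤ 2 / m := by gcongr
        _ ≤ 1 := by rw [div_le_one (by linarith)]; exact hmR
        _ ≤ (svlQ m T : ℝ) := hQ1
    · push Not at hm7
      refine hdiv.trans ?_
      -- m ≥ 7: pad from (m-1, T' = 2^(m-4))
      obtain ⟨m', rfl⟩ : ∃ m', m = m' + 1 := ⟨m - 1, by omega⟩
      have hm'6 : 6 ≤ m' := by omega
      set T' : ℕ := 2 ^ (m' - 3) with hT'
      have hT'pos : 1 ≤ T' := Nat.one_le_two_pow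
      have h8T' : 8 * T' ≤ 2 ^ m' := by
        rw [hT', show (8 : ℕ) = 2 ^ 3 by norm_num, ← pow_add]
        exact Nat.pow_le_pow_right (by norm_num) (by omega)
      have hT'T : T' < T := by
        have : 2 ^ (m' + 1) < 8 * T := h8
        have h2 : 2 ^ (m' + 1) = 16 * 2 ^ (m' - 3) := by
          rw [show (16 : ℕ) = 2 ^ 4 by norm_num, ← pow_add]
          congr 1
          omega
        omega
      have hTle : T ≤ 2 ^ m' := by
        have := hTm
        simp only [Nat.add_sub_cancel] at this
        omega
      have hpad := hP m' T T' (by omega) hT'T hTle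
      have hadv := hA m' T' hT'pos h8T'
      have hQ : κ * min (T' : ℝ) (Real.sqrt (2 ^ m')) ≤ (svlQ (m' + 1) T : ℝ) :=
        hadv.trans (by exact_mod_cast hpad)
      have hkey : Real.sqrt (2 ^ (m' + 1)) ≤ 2 * min (T' : ℝ) (Real.sqrt (2 ^ m')) := by
        have hs1 : Real.sqrt (2 ^ (m' + 1)) ≤ 2 * Real.sqrt (2 ^ m') := by
          rw [show (2 : ℝ) * Real.sqrt (2 ^ m') = Real.sqrt (2 ^ 2 * 2 ^ m') by
            rw [Real.sqrt_mul (by positivity), Real.sqrt_sq (by norm_num)]]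
          exact Real.sqrt_le_sqrt (by rw [pow_succ]; nlinarith [pow_pos (by norm_num : (0:ℝ) < 2) m'])
        have hs2 : Real.sqrt (2 ^ (m' + 1)) ≤ 2 * (T' : ℝ) := by
          have hT'R : (T' : ℝ) = (2 : ℝ) ^ (m' - 3) := by rw [hT']; norm_cast
          rw [show (2 : ℝ) * T' = Real.sqrt ((2 * T') ^ 2) from (Real.sqrt_sq (by positivity)).symm]
          apply Real.sqrt_le_sqrt
          rw [hT'R, mul_pow, ← pow_mul, show (2:ℝ)^2 = 2^(2:ℕ) by norm_num, ← pow_add]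
          exact pow_le_pow_right₀ (by norm_num) (by omega)
        rcases le_total (T' : ℝ) (Real.sqrt (2 ^ m')) with h | h
        · rw [min_eq_left h]; exact hs2
        · rw [min_eq_right h]; exact hs1
      calc c * min ((T : ℝ) + 1) (Real.sqrt (2 ^ (m' + 1)))
          ≤ c * Real.sqrt (2 ^ (m' + 1)) := by gcongr; exact min_le_right _ _
        _ ≤ (κ / 2) * (2 * min (T' : ℝ) (Real.sqrt (2 ^ m'))) := by gcongr
        _ = κ * min (T' : ℝ) (Real.sqrt (2 ^ m')) := by ring
        _ ≤ (svlQ (m' + 1) T : ℝ) := hQ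


/-! ## §6 Attack ledger and why the crux resists (prose)

### 6.1 What a kill would have to be
By §3 (`pointwise_bound`) a refutation is an infinite family `(m_k, T_k)` of admissible parameters
with `Q(m_k, T_k) · m_k / min(T_k + 1, 2^{m_k/2}) → 0`, i.e. a quantum algorithm for the sink
parity using `o(min(T, 2^{m/2})/m)` BIT queries — formalised in the matrix model. Upper bounds
known: `Q ≤ m·T` (walk, `svlQ_le_mul`), `Q ≤ 54·2^{m/2}` (Grover on the odd half of the column `V(·,T)`,
§5, proved), and trivially `Q ≤ (m/2 + o(m))·(T-1) + 1` (van Dam reading of each row). So the crux is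
tight up to `m²` and constants in every regime; a kill needs a NEW algorithmic idea, not slack.

### 6.2 Candidate algorithms tried (all fail to beat `min(T, 2^{m/2})`)
Write `N = 2^m`. Costs in name-queries (bit-queries only cost more).
1. Walk: `T` sequential S-steps. Grover on `V(·,T)`: `Θ(√N)`. Baselines.
2. "Verified jumping" (the planner's worry): Grover for a vertex `x` with `V(x,i) = 1` for some
   `i` in a window `W = [T-L, T]`, then walk `L` steps. Inner check "index of `x` in `W`" costs
   `√L` (nested Grover, ≤ 1 solution), outer amplification `√(N/L)` rounds (`L` good names out
   of `N`): total `√(N/L)·√L + L = √N + L`. NO GAIN: `V` is a point function on (name, index)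
   PAIRS; any `V`-based landing is a search among `N·|W|` pairs with `|W|` marked ⇒ `√N`.
3. Walk-then-verify from random starts: `F_L(y) = V(S^L(y), T)`; solutions `y = x_{T-L}` (plus
   off-line preimages, adversarially none). Grover over `y`: `√N` rounds × `L·m` queries. Worse.
   With a window of walk lengths `[0, L)`: `L` solutions, `√(N/L)` rounds × `L` sequential steps
   = `L^{1/2} √N`. Worse. (Sequential inner walk cannot be Groverised: Ozhigov.)
4. Level sampling (regime `T ≈ N/2`, where a random name is on the line w.p. `1/2`): find the
   index of an on-line `y` by Grover over `i` (`√T`), keep the max of `K` samples, walk the rest: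
   `K√T + T/K ≥ T^{3/4} ≫ √N`. Worse.
5. Structural detection of the sink through `S` alone: impossible — `S` is unconstrained off the
   line AND at the sink, so in the hard distribution (random `S` off-line) the sink has no
   `S`-local signature (in-degree `1 + Poisson`, out-arrow random, like every visited off-line
   vertex); every point of `S(x_T), S(S(x_T)), …` has a predecessor chain as long as the sink's.
   Only `V(·, T)` defines the sink.
6. Collision / element-distinctness style walks (Ambainis): find structure in `N^{2/3}`; there is
   no collision structure correlated with the sink. Not applicable.
7. Exploiting "accidental hits": S-queries on a spread-out superposition put squared amplitude
   `≈ T/N` per query on line rows `x_{>j}` (this is exactly the slack in the naive hybrid bound,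
   6.3). Classically an accidental hit is undetectable (answers off-line are random names too);
   quantumly, amplitude on an UNFLAGGED subspace cannot be amplified — amplitude amplification
   needs a reflection about the good subspace, i.e. a checker, and the only checkers are the
   point functions `V(·, i)` (back to item 2). I could not turn accidental hits into an algorithm.

### 6.3 Where the obvious proof falls short (information for provers)
Hybrid argument over the random instance (line uniformly random injective, `S` random off-line),
truncation hybrids `H_j` (line cut after `x_j`; oracle at query `j` replaced by `H_j`): the state
before query `j` depends only on `x_0..x_{j-1}`, the positions where `H_j` and the true oracle
differ are the S-rows `x_j..x_{T-1}` and the V-entries `(x_i, i)`, `i > j`; their expected query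
mass is `≤ (T-j+1)/(N-j)` (S-rows: the UNKNOWN line points are uniform among unused names) plus
`1/(N-T)` (V-entries: a pair `(x,i)` is hit only if `x_i = x`). BBBV swapping then gives
`E‖ψ_Q − ψ_Q^{hyb}‖ ≤ 2Q √(2(T+1)/N)` and, since the fully hybridised run is independent of
`x_T` when `Q < T`, the bound `Q ≥ min(T, (1/34)·√(N/(T+1)))`. THIS PROVES THE CRUX (even
without the `1/m`) IN THE REGIME `T + 1 ≤ N^{1/3}`, and proves `Ω(N^{1/4})` up to `T ≈ √N`;
it falls short of `c·min(T+1, √N)/m` exactly when `(T+1)^3 > N / (34 c/m)^2…`, i.e. for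
`T ≳ N^{1/3}`: the S-row term `(T-j)/N` ("accidental hits") is the loss. Closing the gap needs
either (a) a finer hybrid that re-randomises only the NEXT unknown row (progress-measure /
"knowledge frontier" induction à la Ozhigov 1998, Ambainis 2000 adversary with the relation
"lines agreeing up to position j"), or (b) the compressed-oracle sequentiality technique that
handles exactly this term for hash chains `x_{i+1} = H(x_i)` with a RANDOM FUNCTION `H` and
large `T` (post-quantum Proofs of Sequential Work: Chung–Fehr–Huang–Liao, EUROCRYPT 2021;
Blocki–Lee–Zhou, ITC 2021; also Unruh's and Zhandry's compressed-oracle papers) — their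
statements are average-case over `H`, which for `T ≪ √N` transfers to the promise (the path of
`0` is simple w.h.p.) but NOT directly for `T ≳ √N`, where however only `Ω(√N/m)` is claimed
and the `V`-column BBBV bound should carry it (hybrid: replace `V(·,T)` and the S-row `x_{T-1}`
… this again needs "mass on row `x_{T-1}` is small unless `≳ min(T, √N)` queries", an induction
on `T`). Literature bounds in print cover the two halves separately (Ozhigov 1998 Thm 1:
`Ω(T)` for `S` alone when `T = O(N^{1/7})`; Thm 2: `Ω(√T)` always; BBBV: `Ω(√N)` for `V` alone);
the joint oracle is new (grounder/planner notes agree; `lit`/galaxy search was unavailable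
(rc 75) during this cycle — to be re-run).

### 6.4 Single-input methods are powerless here
On the promise, at EVERY instance `I` with line `xs`: the one bit `V(x_T, T) = 1` is a
certificate for the value of the sink bit (given the promise it pins the sink), so
`C_D(f, I) = 1`; and every sensitive block (a set of positions whose flip stays in the promise
and flips the parity of the sink) must contain the position `V(x_T, T)` (the sink must move), so
promise block sensitivity is `1`. Hence `card_le_of_isSensitiveFamily`-type bounds
(QueryHybridBound.lean) give only `Q ≥ 1/12`, and polynomial-degree-on-the-promise arguments
are equally blind. The hardness is purely distributional (needle position × sequential depth),
which is why the prover must run a hybrid over a DISTRIBUTION of instances (6.3).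

### 6.5 Structural remark
The crux is calibration only: `WhiteBoxWalk.closes` uses `WbwThesis`, `WbwPromiseLift`,
`WbwSearchToPromise`; proving or refuting 2239 changes no other item's status (refuter
route-review note 2026-08-15 agrees). Its informal role is the (N)-branch of the card's dichotomy.

### 6.6 Mutations summary (for the planner)
* `2 ≤ m`: redundant (`two_le_of_hyps`).
* `1 ≤ T`: necessary (`…_false_without_Tpos`).
* `T + 1 ≤ 2^(m-1)`: some bound `T + 1 ≤ 2^m` necessary (`…_false_without_Tbound`); the factor
  `1/2` is convenience.
* `/ m`: dropping it (name-query strength) gives a stronger, still plausible statement; not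
  refutable by anything here (`Q(m,1) = 1 ≥ 2c` only forces `c ≤ 1/2`).
* `min ↦ √(2^m)` alone: FALSE (`not_groverBranchOnly`). `min ↦ T+1` alone: FALSE (`not_walkBranchOnly`, §5).
* constant: any admissible `c ≤ 1` (`admissible_const_le_one`).
-/

end Summit.QuantumAdvantage.QuantumAdvantage.Cruxes.WbwVerifiableLineNoSpeedup.Disproof
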